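import Mathlib
import HarnessLib
import Summits.Ventures.LatticeQCDFlow.Scaling.PlaquettePeelingClosingBound
import Summits.Ventures.LatticeQCDFlow.Scaling.PlaquetteSharedLinkManyPeeling

/-!
# LatticeQCDFlow / Scaling — peeling with a CLOSING MAP: every uncovered plaquette closed by a covered top
# link pays, and a closer that closes `n` of them pays the many-plaquette constant `c_{n+1} = ∫ w^{n+1}`

HONEST FRAMING: exact (Metropolis-corrected) sampling algorithms for lattice gauge theory;
figures of merit are autocorrelation/cost numbers at stated couplings and volumes; no
continuum-physics claim.

Venture `LatticeQCDFlow` (cell pub-lqcd), topic `Scaling`, FANOUT row 30 (lean-1, GEN-27) — OUR WORK on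
THEORY-2.md §4 row C5, sharpening the LOWER half of the volume law.  `PlaquettePeelingClosingBound` (GEN-26)
peeled a ranked structure `(B, t, rank)` together with a CLOSING SECTION — an INJECTIVE partial assignment
`u` of uncovered plaquettes to covered closers — and got `Z ≤ c^{#B} M^{k−s} M₂^{s}`: one factor `M₂ < M` per
closer used.  Here the injectivity is dropped: a CLOSING MAP `u : S → B` (`S ⊆ Bᶜ`, `t (u p')` a link of `p'`,
`rank p < rank (u p')` for every other covered `p` whose top link lies on `p'`) may send several uncovered
plaquettes to the same closer `a`; when the link `t a` is drawn it closes `a` and ALL of `u⁻¹(a)` at once, and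
the draw is worth `c_{n_a+1} = ∫ w^{n_a+1} dHaar` (`n_a = #u⁻¹(a)`; `PlaquetteSharedLinkManyPeeling`,
`PlaquetteManyWeightConstant`: AM–GM) instead of `c·M^{n_a}`:

* **`integral_prod_weight_mul_prod_closingMap_le`** — `∫ F_B · ∏_{p'∈S, u p'∈B} w(U_{p'}) dHaar^{⊗E} ≤
  ∏_{a∈B} c_{n_a+1}` (induction on the maximal rank, peeling `a` with its whole fibre);
* **`integral_prod_weight_le_of_closingMap`** — `Z ≤ M^{k−#S} · ∏_{a∈B} c_{n_a+1}` when `u(S) ⊆ B`;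
* **`integral_prod_weight_div_le_of_closingMap`** — `Z/Z_B ≤ M^{k−#S} · ∏_{a∈B} (c_{n_a+1}/c)`: EVERY closed
  uncovered plaquette trades its factor `M` for a share of a many-plaquette constant, and
  `c_{n+1}/c < Mⁿ` strictly for `n ≥ 1` (`PlaquetteManyWeightConstant.integral_pow_lt`).

For OPTIMAL structures every uncovered plaquette carries a covered top link (`TorusClosingSection`), so `S = Bᶜ`
is admissible and ALL `k_min` uncovered plaquettes pay (sequel).  No `def`, no `sorry`, nothing cited as a
fact beyond the tree.
-/

noncomputable section

namespace Summit.Ventures.LatticeQCDFlow.Theory2.Autoregressive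

open MeasureTheory Function Finset
open Literature.MathematicalPhysics.QuantumFieldTheory Literature.MathematicalPhysics.QuantumLattice
open Summit.Ventures.LatticeQCDFlow.Exactness

variable {d L : ℕ} [NeZero L] {G : Type*} [Group G] [TopologicalSpace G] [IsTopologicalGroup G]
  [CompactSpace G] [SecondCountableTopology G] [MeasurableSpace G] [BorelSpace G]

/-! ## Peeling a ranked structure together with a closing map -/

/-- **The closing-map peeling bound.**  `L ≥ 2`; `w` continuous, `0 < m ≤ w ≤ M`; `(B, t, rank)` ranked;
`S` disjoint from `B` with a map `u` such that `t (u p')` is a link of `p'` and `rank p < rank (u p')` for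
every OTHER `p ∈ B` whose top link lies on `p'` (no injectivity).  Then
`∫ (∏_{p∈B} w(U_p)) · ∏_{p' ∈ S, u p' ∈ B} w(U_{p'}) dHaar^{⊗E} ≤ ∏_{a∈B} ∫ w^{#{p'∈S : u p' = a} + 1} dHaar`.
[ours] -/
theorem integral_prod_weight_mul_prod_closingMap_le (hL : 2 ≤ L) {w : G → ℝ} (hw : Continuous w)
    {m M : ℝ} (hm0 : 0 < m) (hm : ∀ g, m ≤ w g) (hM : ∀ g, w g ≤ M)
    (B : Finset (Plaquette d L)) (t : Plaquette d L → Edge d L)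
    (ht : ∀ p ∈ B, t p ∈ ({(p.1, p.2.1.1), (p.1.shift p.2.1.1, p.2.1.2),
        (p.1.shift p.2.1.2, p.2.1.1), (p.1, p.2.1.2)} : Finset (Edge d L)))
    (rank : Plaquette d L → ℕ)
    (hrank : ∀ p ∈ B, ∀ p' ∈ B, p ≠ p' → t p ∈ ({(p'.1, p'.2.1.1), (p'.1.shift p'.2.1.1, p'.2.1.2),
        (p'.1.shift p'.2.1.2, p'.2.1.1), (p'.1, p'.2.1.2)} : Finset (Edge d L)) → rank p < rank p')
    (S : Finset (Plaquette d L)) (u : Plaquette d L → Plaquette d L) (hSB : ∀ p' ∈ S, p' ∉ B)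
    (hut : ∀ p' ∈ S, t (u p') ∈ ({(p'.1, p'.2.1.1), (p'.1.shift p'.2.1.1, p'.2.1.2),
        (p'.1.shift p'.2.1.2, p'.2.1.1), (p'.1, p'.2.1.2)} : Finset (Edge d L)))
    (humax : ∀ p' ∈ S, ∀ p ∈ B, p ≠ u p' → t p ∈ ({(p'.1, p'.2.1.1), (p'.1.shift p'.2.1.1, p'.2.1.2),
        (p'.1.shift p'.2.1.2, p'.2.1.1), (p'.1, p'.2.1.2)} : Finset (Edge d L)) → rank p < rank (u p')) :
    ∫ U, (∏ p ∈ B, w (plaquetteHolonomy U p.1 p.2.1.1 p.2.1.2)) *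
        ∏ p' ∈ S.filter (fun p' => u p' ∈ B), w (plaquetteHolonomy U p'.1 p'.2.1.1 p'.2.1.2)
        ∂(Measure.pi fun _ : Edge d L => haarProbability G) ≤
      ∏ a ∈ B, ∫ h, w h ^ ((S.filter (fun p' => u p' = a)).card + 1) ∂(haarProbability G) := by
  classical
  have hw0 : ∀ g, 0 < w g := fun g => hm0.trans_le (hm g)
  have hMpos : 0 < M := (hw0 1).trans_le (hM 1)
  have hcn : ∀ n : ℕ, 0 ≤ ∫ h, w h ^ n ∂(haarProbability G) := fun n =>
    integral_nonneg fun h => pow_nonneg (hw0 h).le n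
  revert ht hrank hSB humax
  refine Finset.induction_on_max_value rank B ?_ ?_
  · intro _ _ _ _
    simp
  · intro a s has hmax ih ht hrank hSB humax
    have hta := ht a (Finset.mem_insert_self a s)
    have hts : ∀ p ∈ s, t p ∈ ({(p.1, p.2.1.1), (p.1.shift p.2.1.1, p.2.1.2),
        (p.1.shift p.2.1.2, p.2.1.1), (p.1, p.2.1.2)} : Finset (Edge d L)) :=
      fun p hp => ht p (Finset.mem_insert_of_mem hp)
    have hranks : ∀ p ∈ s, ∀ p' ∈ s, p ≠ p' → t p ∈ ({(p'.1, p'.2.1.1), (p'.1.shift p'.2.1.1, p'.2.1.2),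
        (p'.1.shift p'.2.1.2, p'.2.1.1), (p'.1, p'.2.1.2)} : Finset (Edge d L)) → rank p < rank p' :=
      fun p hp p' hp' => hrank p (Finset.mem_insert_of_mem hp) p' (Finset.mem_insert_of_mem hp')
    have hSBs : ∀ p' ∈ S, p' ∉ s := fun p' hp' h => hSB p' hp' (Finset.mem_insert_of_mem h)
    have humaxs : ∀ p' ∈ S, ∀ p ∈ s, p ≠ u p' → t p ∈ ({(p'.1, p'.2.1.1), (p'.1.shift p'.2.1.1, p'.2.1.2),
        (p'.1.shift p'.2.1.2, p'.2.1.1), (p'.1, p'.2.1.2)} : Finset (Edge d L)) → rank p < rank (u p') :=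
      fun p' hp' p hp => humax p' hp' p (Finset.mem_insert_of_mem hp)
    have ih' := ih hts hranks hSBs humaxs
    -- the top link of `a` lies on no plaquette of `s` (maximality of `rank a`)
    have hfree : ∀ p ∈ s, t a ∉ ({(p.1, p.2.1.1), (p.1.shift p.2.1.1, p.2.1.2),
        (p.1.shift p.2.1.2, p.2.1.1), (p.1, p.2.1.2)} : Finset (Edge d L)) := by
      intro p hp hmem
      have hne : a ≠ p := fun h => has (h ▸ hp)
      have := hrank a (Finset.mem_insert_self a s) p (Finset.mem_insert_of_mem hp) hne hmem
      exact absurd (hmax p hp) (not_le.2 this)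
    -- … and on no plaquette of `S` whose closer lies in `s`
    have hfreeS : ∀ p' ∈ S.filter (fun p' => u p' ∈ s), t a ∉ ({(p'.1, p'.2.1.1), (p'.1.shift p'.2.1.1, p'.2.1.2),
        (p'.1.shift p'.2.1.2, p'.2.1.1), (p'.1, p'.2.1.2)} : Finset (Edge d L)) := by
      intro p' hp' hmem
      rw [Finset.mem_filter] at hp'
      have hne : a ≠ u p' := fun h => has (h ▸ hp'.2)
      have h1 := humax p' hp'.1 a (Finset.mem_insert_self a s) hne hmem
      exact absurd (hmax (u p') hp'.2) (not_le.2 h1)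
    -- the remaining product is blind to the link `t a`
    set Φ : GaugeConfig d L G → ℝ := fun U =>
      (∏ p ∈ s, w (plaquetteHolonomy U p.1 p.2.1.1 p.2.1.2)) *
        ∏ p' ∈ S.filter (fun p' => u p' ∈ s), w (plaquetteHolonomy U p'.1 p'.2.1.1 p'.2.1.2) with hΦ
    have hΦe : ∀ U v, Φ (update U (t a) v) = Φ U := by
      intro U v
      simp only [hΦ]
      congr 1
      · refine Finset.prod_congr rfl fun p hp => ?_
        have h := hfree p hp
        simp only [Finset.mem_insert, Finset.mem_singleton, not_or] at h
        obtain ⟨h1, h2, h3, h4⟩ := h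
        rw [plaquetteHolonomy_update_of_ne U v (Ne.symm h1) (Ne.symm h2) (Ne.symm h3) (Ne.symm h4)]
      · refine Finset.prod_congr rfl fun p' hp' => ?_
        have h := hfreeS p' hp'
        simp only [Finset.mem_insert, Finset.mem_singleton, not_or] at h
        obtain ⟨h1, h2, h3, h4⟩ := h
        rw [plaquetteHolonomy_update_of_ne U v (Ne.symm h1) (Ne.symm h2) (Ne.symm h3) (Ne.symm h4)]
    have hΦm : Measurable Φ :=
      (Finset.measurable_prod s fun p _ =>
        hw.measurable.comp (measurable_plaquetteHolonomy p.1 p.2.1.1 p.2.1.2)).mul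
      (Finset.measurable_prod _ fun p' _ =>
        hw.measurable.comp (measurable_plaquetteHolonomy p'.1 p'.2.1.1 p'.2.1.2))
    have hΦpos : ∀ U, 0 < Φ U := fun U =>
      mul_pos (prod_pos fun p _ => hw0 _) (prod_pos fun p _ => hw0 _)
    have hΦb : ∀ U, |Φ U| ≤ M ^ s.card * M ^ (S.filter (fun p' => u p' ∈ s)).card := by
      intro U
      rw [abs_of_pos (hΦpos U), hΦ]
      refine mul_le_mul ?_ ?_ (prod_pos fun p _ => hw0 _).le (pow_nonneg hMpos.le _)
      · rw [← Finset.prod_const]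
        exact Finset.prod_le_prod (fun p _ => (hw0 _).le) fun p _ => hM _
      · rw [← Finset.prod_const]
        exact Finset.prod_le_prod (fun p _ => (hw0 _).le) fun p _ => hM _
    -- split the closing product at `a`: the fibre of `a` and the rest
    have hsplit : S.filter (fun p' => u p' ∈ insert a s) =
        S.filter (fun p' => u p' = a) ∪ S.filter (fun p' => u p' ∈ s) := by
      ext p'
      simp only [Finset.mem_filter, Finset.mem_insert, Finset.mem_union]
      tauto
    have hdisj : Disjoint (S.filter (fun p' => u p' = a)) (S.filter (fun p' => u p' ∈ s)) :=
      Finset.disjoint_filter.2 fun p' _ h1 h2 => has (h1 ▸ h2)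
    -- the peeled set: `a` with its whole fibre, all containing `t a`
    set F : Finset (Plaquette d L) := insert a (S.filter (fun p' => u p' = a)) with hF
    have haF : a ∉ S.filter (fun p' => u p' = a) := fun h =>
      hSB a (Finset.mem_filter.1 h).1 (Finset.mem_insert_self a s)
    have hFne : F.Nonempty := ⟨a, Finset.mem_insert_self _ _⟩
    have hFcard : F.card = (S.filter (fun p' => u p' = a)).card + 1 := by
      rw [hF, Finset.card_insert_of_notMem haF]
    have heF : ∀ p ∈ F, t a ∈ ({(p.1, p.2.1.1), (p.1.shift p.2.1.1, p.2.1.2),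
        (p.1.shift p.2.1.2, p.2.1.1), (p.1, p.2.1.2)} : Finset (Edge d L)) := by
      intro p hp
      rcases Finset.mem_insert.1 hp with rfl | hp'
      · exact hta
      · have h := Finset.mem_filter.1 hp'
        have := hut p h.1
        rwa [h.2] at this
    have hstep := integral_prod_weight_mul_le_pow (G := G) hL F hFne heF hw hw0 hM hΦm hΦb
      (fun U => (hΦpos U).le) hΦe
    rw [hsplit, Finset.prod_insert has]
    simp_rw [Finset.prod_union hdisj, Finset.prod_insert has]
    calc ∫ U, w (plaquetteHolonomy U a.1 a.2.1.1 a.2.1.2) * (∏ p ∈ s, w (plaquetteHolonomy U p.1 p.2.1.1 p.2.1.2)) *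
            ((∏ p' ∈ S.filter (fun p' => u p' = a), w (plaquetteHolonomy U p'.1 p'.2.1.1 p'.2.1.2)) *
              ∏ p' ∈ S.filter (fun p' => u p' ∈ s), w (plaquetteHolonomy U p'.1 p'.2.1.1 p'.2.1.2))
            ∂(Measure.pi fun _ : Edge d L => haarProbability G)
        = ∫ U, (∏ p ∈ F, w (plaquetteHolonomy U p.1 p.2.1.1 p.2.1.2)) * Φ U ∂(Measure.pi fun _ : Edge d L => haarProbability G) := by
          refine integral_congr_ae (ae_of_all _ fun U => ?_)
          simp only [hΦ, hF, Finset.prod_insert haF]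
          ring
      _ ≤ (∫ h, w h ^ (F.card) ∂(haarProbability G)) * ∫ U, Φ U ∂(Measure.pi fun _ : Edge d L => haarProbability G) := hstep
      _ ≤ (∫ h, w h ^ (F.card) ∂(haarProbability G)) *
            ∏ a' ∈ s, ∫ h, w h ^ ((S.filter (fun p' => u p' = a')).card + 1) ∂(haarProbability G) :=
          mul_le_mul_of_nonneg_left ih' (hcn _)
      _ = (∫ h, w h ^ ((S.filter (fun p' => u p' = a)).card + 1) ∂(haarProbability G)) *
            ∏ a' ∈ s, ∫ h, w h ^ ((S.filter (fun p' => u p' = a')).card + 1) ∂(haarProbability G) := by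
          rw [hFcard]

/-- **`Z ≤ M^{k−#S} · ∏_{a∈B} c_{n_a+1}`.**  Same setting with the closing map landing in `B` (`u p' ∈ B` for
every `p' ∈ S`; `k = #Bᶜ`): against the squeeze `Z ≤ c^{#B} M^k`, every uncovered plaquette in `S` trades
its factor `M` for a share of its closer's many-plaquette constant. [ours] -/
theorem integral_prod_weight_le_of_closingMap (hL : 2 ≤ L) {w : G → ℝ} (hw : Continuous w)
    {m M : ℝ} (hm0 : 0 < m) (hm : ∀ g, m ≤ w g) (hM : ∀ g, w g ≤ M)
    (B : Finset (Plaquette d L)) (t : Plaquette d L → Edge d L)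
    (ht : ∀ p ∈ B, t p ∈ ({(p.1, p.2.1.1), (p.1.shift p.2.1.1, p.2.1.2),
        (p.1.shift p.2.1.2, p.2.1.1), (p.1, p.2.1.2)} : Finset (Edge d L)))
    (rank : Plaquette d L → ℕ)
    (hrank : ∀ p ∈ B, ∀ p' ∈ B, p ≠ p' → t p ∈ ({(p'.1, p'.2.1.1), (p'.1.shift p'.2.1.1, p'.2.1.2),
        (p'.1.shift p'.2.1.2, p'.2.1.1), (p'.1, p'.2.1.2)} : Finset (Edge d L)) → rank p < rank p')
    (S : Finset (Plaquette d L)) (u : Plaquette d L → Plaquette d L) (hSB : ∀ p' ∈ S, p' ∉ B)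
    (huB : ∀ p' ∈ S, u p' ∈ B)
    (hut : ∀ p' ∈ S, t (u p') ∈ ({(p'.1, p'.2.1.1), (p'.1.shift p'.2.1.1, p'.2.1.2),
        (p'.1.shift p'.2.1.2, p'.2.1.1), (p'.1, p'.2.1.2)} : Finset (Edge d L)))
    (humax : ∀ p' ∈ S, ∀ p ∈ B, p ≠ u p' → t p ∈ ({(p'.1, p'.2.1.1), (p'.1.shift p'.2.1.1, p'.2.1.2),
        (p'.1.shift p'.2.1.2, p'.2.1.1), (p'.1, p'.2.1.2)} : Finset (Edge d L)) → rank p < rank (u p')) :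
    ∫ U, ∏ p : Plaquette d L, w (plaquetteHolonomy U p.1 p.2.1.1 p.2.1.2) ∂(Measure.pi fun _ : Edge d L => haarProbability G) ≤
      M ^ ((Finset.univ \ B).card - S.card) *
        ∏ a ∈ B, ∫ h, w h ^ ((S.filter (fun p' => u p' = a)).card + 1) ∂(haarProbability G) := by
  classical
  have hw0 : ∀ g, 0 < w g := fun g => hm0.trans_le (hm g)
  have hMpos : 0 < M := (hw0 1).trans_le (hM 1)
  have hcn : ∀ n : ℕ, 0 ≤ ∫ h, w h ^ n ∂(haarProbability G) := fun n =>
    integral_nonneg fun h => pow_nonneg (hw0 h).le n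
  have hSsub : S ⊆ Finset.univ \ B := fun p' hp' => Finset.mem_sdiff.2 ⟨Finset.mem_univ _, hSB p' hp'⟩
  have hfilt : S.filter (fun p' => u p' ∈ B) = S := Finset.filter_true_of_mem fun p' hp' => huB p' hp'
  have hkey := integral_prod_weight_mul_prod_closingMap_le (G := G) hL hw hm0 hm hM B t ht rank hrank S u hSB
    hut humax
  rw [hfilt] at hkey
  set FB : GaugeConfig d L G → ℝ := fun U => ∏ p ∈ B, w (plaquetteHolonomy U p.1 p.2.1.1 p.2.1.2) with hFB
  set FS : GaugeConfig d L G → ℝ := fun U => ∏ p ∈ S, w (plaquetteHolonomy U p.1 p.2.1.1 p.2.1.2) with hFS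
  set FO : GaugeConfig d L G → ℝ := fun U =>
    ∏ p ∈ (Finset.univ \ B) \ S, w (plaquetteHolonomy U p.1 p.2.1.1 p.2.1.2) with hFO
  have hsplit : ∀ U, (∏ p : Plaquette d L, w (plaquetteHolonomy U p.1 p.2.1.1 p.2.1.2)) = FO U * (FB U * FS U) := by
    intro U
    rw [← Finset.prod_sdiff (Finset.subset_univ B), ← Finset.prod_sdiff hSsub, hFO, hFB, hFS]
    ring
  have hcard : ((Finset.univ \ B) \ S).card = (Finset.univ \ B).card - S.card :=
    Finset.card_sdiff_of_subset hSsub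
  have hFOle : ∀ U, FO U ≤ M ^ ((Finset.univ \ B).card - S.card) := by
    intro U
    rw [hFO, ← hcard, ← Finset.prod_const]
    exact Finset.prod_le_prod (fun p _ => (hw0 _).le) fun p _ => hM _
  have hprodpos : ∀ U, 0 < FB U * FS U := fun U =>
    mul_pos (prod_pos fun p _ => hw0 _) (prod_pos fun p _ => hw0 _)
  have hmeas : Measurable fun U : GaugeConfig d L G => FB U * FS U :=
    (Finset.measurable_prod B fun p _ =>
      hw.measurable.comp (measurable_plaquetteHolonomy p.1 p.2.1.1 p.2.1.2)).mul
    (Finset.measurable_prod S fun p _ =>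
      hw.measurable.comp (measurable_plaquetteHolonomy p.1 p.2.1.1 p.2.1.2))
  haveI : IsProbabilityMeasure (Measure.pi fun _ : Edge d L => haarProbability G) := by infer_instance
  have hint : Integrable (fun U : GaugeConfig d L G => FB U * FS U) (Measure.pi fun _ : Edge d L => haarProbability G) := by
    refine Integrable.mono' (integrable_const (M ^ B.card * M ^ S.card)) hmeas.aestronglyMeasurable
      (ae_of_all _ fun U => ?_)
    rw [Real.norm_eq_abs, abs_of_pos (hprodpos U), hFB, hFS]
    refine mul_le_mul ?_ ?_ (prod_pos fun p _ => hw0 _).le (pow_nonneg hMpos.le _)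
    · rw [← Finset.prod_const]
      exact Finset.prod_le_prod (fun p _ => (hw0 _).le) fun p _ => hM _
    · rw [← Finset.prod_const]
      exact Finset.prod_le_prod (fun p _ => (hw0 _).le) fun p _ => hM _
  calc ∫ U, ∏ p : Plaquette d L, w (plaquetteHolonomy U p.1 p.2.1.1 p.2.1.2) ∂(Measure.pi fun _ : Edge d L => haarProbability G)
      = ∫ U, FO U * (FB U * FS U) ∂(Measure.pi fun _ : Edge d L => haarProbability G) := by simp_rw [hsplit]
    _ ≤ ∫ U, M ^ ((Finset.univ \ B).card - S.card) * (FB U * FS U) ∂(Measure.pi fun _ : Edge d L => haarProbability G) :=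
        integral_mono_of_nonneg
          (ae_of_all _ fun U => mul_nonneg (prod_pos fun p _ => hw0 _).le (hprodpos U).le)
          (hint.const_mul _)
          (ae_of_all _ fun U => mul_le_mul_of_nonneg_right (hFOle U) (hprodpos U).le)
    _ = M ^ ((Finset.univ \ B).card - S.card) * ∫ U, FB U * FS U ∂(Measure.pi fun _ : Edge d L => haarProbability G) := integral_const_mul _ _
    _ ≤ M ^ ((Finset.univ \ B).card - S.card) *
          ∏ a ∈ B, ∫ h, w h ^ ((S.filter (fun p' => u p' = a)).card + 1) ∂(haarProbability G) :=
        mul_le_mul_of_nonneg_left hkey (pow_nonneg hMpos.le _)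

/-- **`Z/Z_B ≤ M^{k−#S} · ∏_{a∈B} (c_{n_a+1}/c)`** — the normalising constant of the block-proposal density
ratio, with `Z_B = c^{#B}` (GEN-23's peeling): every closed uncovered plaquette pays through its closer, and
`c_{n+1}/c < Mⁿ` for `n ≥ 1` and non-constant `w` (`PlaquetteManyWeightConstant.integral_pow_lt`). [ours] -/
theorem integral_prod_weight_div_le_of_closingMap (hL : 2 ≤ L) {w : G → ℝ} (hw : Continuous w)
    {m M : ℝ} (hm0 : 0 < m) (hm : ∀ g, m ≤ w g) (hM : ∀ g, w g ≤ M)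
    (B : Finset (Plaquette d L)) (t : Plaquette d L → Edge d L)
    (ht : ∀ p ∈ B, t p ∈ ({(p.1, p.2.1.1), (p.1.shift p.2.1.1, p.2.1.2),
        (p.1.shift p.2.1.2, p.2.1.1), (p.1, p.2.1.2)} : Finset (Edge d L)))
    (rank : Plaquette d L → ℕ)
    (hrank : ∀ p ∈ B, ∀ p' ∈ B, p ≠ p' → t p ∈ ({(p'.1, p'.2.1.1), (p'.1.shift p'.2.1.1, p'.2.1.2),
        (p'.1.shift p'.2.1.2, p'.2.1.1), (p'.1, p'.2.1.2)} : Finset (Edge d L)) → rank p < rank p')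
    (S : Finset (Plaquette d L)) (u : Plaquette d L → Plaquette d L) (hSB : ∀ p' ∈ S, p' ∉ B)
    (huB : ∀ p' ∈ S, u p' ∈ B)
    (hut : ∀ p' ∈ S, t (u p') ∈ ({(p'.1, p'.2.1.1), (p'.1.shift p'.2.1.1, p'.2.1.2),
        (p'.1.shift p'.2.1.2, p'.2.1.1), (p'.1, p'.2.1.2)} : Finset (Edge d L)))
    (humax : ∀ p' ∈ S, ∀ p ∈ B, p ≠ u p' → t p ∈ ({(p'.1, p'.2.1.1), (p'.1.shift p'.2.1.1, p'.2.1.2),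
        (p'.1.shift p'.2.1.2, p'.2.1.1), (p'.1, p'.2.1.2)} : Finset (Edge d L)) → rank p < rank (u p')) :
    (∫ U, ∏ p : Plaquette d L, w (plaquetteHolonomy U p.1 p.2.1.1 p.2.1.2) ∂(Measure.pi fun _ : Edge d L => haarProbability G)) /
      (∫ U, ∏ p ∈ B, w (plaquetteHolonomy U p.1 p.2.1.1 p.2.1.2) ∂(Measure.pi fun _ : Edge d L => haarProbability G)) ≤
      M ^ ((Finset.univ \ B).card - S.card) *
        ∏ a ∈ B, ((∫ h, w h ^ ((S.filter (fun p' => u p' = a)).card + 1) ∂(haarProbability G)) /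
          ∫ g, w g ∂(haarProbability G)) := by
  have hw0 : ∀ g, 0 < w g := fun g => hm0.trans_le (hm g)
  have hc : 0 < ∫ g, w g ∂(haarProbability G) := haarProbability_integral_pos_of_continuous_pos hw hw0
  rw [integral_prod_weight_eq_pow_of_rank (G := G) hL hw hm0 hm hM B t ht rank hrank,
    div_le_iff₀ (pow_pos hc _), Finset.prod_div_distrib, Finset.prod_const, mul_assoc,
    div_mul_cancel₀ _ (pow_ne_zero _ hc.ne')]
  exact integral_prod_weight_le_of_closingMap (G := G) hL hw hm0 hm hM B t ht rank hrank S u hSB huB hut humax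

end Summit.Ventures.LatticeQCDFlow.Theory2.Autoregressive

end
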